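import Summits.KontsevichZagierPeriods.KontsevichZagierPeriods.Theorems.SoloInformedElementaryOne
import HarnessLib
import HarnessLib.Audit

/-!
# SoloInformed — `∫ (A + B√(ax² + bx + c))/C dx` for an arbitrary non-degenerate quadratic over `K`

Solo programme `solo-KontsevichZagierPeriods-informed`, session s112, file 33.

The normal forms of files 30–32 are produced inside Lean: for `a, b, c ∈ K` (`K = ℝ ∩ ℚ̄`) with
`a ≠ 0`, `Δ = b² − 4ac ≠ 0`, completing the square and taking square roots IN `K`
(`soloInformed_exists_K_sqrt`: `K` is closed under `√` of non-negative elements) gives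
`ax² + bx + c = a((x − β)² ± α²)` resp. `(−a)(α² − (x − β)²)` with `α, β, √|a| ∈ K`, and the only
hypothesis on the domain is the honest one, `q ≥ 0` on `D`.  THEOREM
(`soloInformed_kzp_sqrt_generalQuadratic`): **for `a, b, c ∈ K`, `a ≠ 0`, `b² ≠ 4ac`,
`A, B, C ∈ K[X]`, and `ℚ`-semialgebraic `D ⊆ {q ≥ 0}` with `C ≠ 0` on `D`, every absolutely convergent
`∫_D (A + B√(ax² + bx + c))/C dx` is KZ-equivalent to every elementary one-variable integral
(file 32), every rational representation of dimension `≤ 1`, and every member of the span of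
points and segments with the same value.**  Unconditional.

References: M. Kontsevich, D. Zagier, *Periods* (2001), §1.1–1.2; A. Baker (1975), Thm. 2.1.
-/

noncomputable section

open scoped BigOperators Polynomial

namespace Summit.KontsevichZagierPeriods.KontsevichZagierPeriods.Theorems

open Set MeasureTheory
open Literature.ModelTheory.ExponentialFields
open Literature.NumberTheory.Transcendental Literature.NumberTheory.Transcendental.KZ

/-- `K = ℝ ∩ ℚ̄` is closed under square roots of non-negative elements. -/
theorem soloInformed_exists_K_sqrt (y : algebraicClosure ℚ ℝ) (hy : 0 ≤ algebraMap _ ℝ y) :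
    ∃ s : algebraicClosure ℚ ℝ, 0 ≤ algebraMap _ ℝ s ∧
      algebraMap _ ℝ s * algebraMap _ ℝ s = algebraMap (algebraicClosure ℚ ℝ) ℝ y := by
  have halg : IsAlgebraic ℚ (Real.sqrt (algebraMap (algebraicClosure ℚ ℝ) ℝ y)) := by
    refine IsAlgebraic.of_pow two_pos ?_
    rw [pow_two, Real.mul_self_sqrt hy]
    exact soloInformed_isAlgebraic_algebraMap_K y
  exact ⟨⟨Real.sqrt (algebraMap _ ℝ y), mem_algebraicClosure_iff.2 halg⟩, Real.sqrt_nonneg _,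
    Real.mul_self_sqrt hy⟩

/-- Completing the square: `ax² + bx + c = a(x + b/2a)² − (b² − 4ac)/4a` packaged with a square
root `s² = ±(b² − 4ac)`: `ax² + bx + c = ax² + bx + (b² − s²∓…)/4a` — the form used below. -/
theorem soloInformed_complete_square {a b c x : ℝ} (ha : a ≠ 0) :
    a * x ^ 2 + b * x + c = a * (x - (-b / (2 * a))) ^ 2 - (b ^ 2 - 4 * a * c) / (4 * a) := by
  field_simp
  ring

/-- If `t ≥ 0`, `t·t = a`, then `√(a·N) = t·√N`. -/
theorem soloInformed_sqrt_mul_of_sq {t a N : ℝ} (ht : 0 ≤ t) (hta : t * t = a) :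
    Real.sqrt (a * N) = t * Real.sqrt N := by
  rw [← hta, Real.sqrt_mul (mul_self_nonneg t), Real.sqrt_mul_self ht]

/-- An empty-domain representation lies in the span (it is a relation). -/
theorem soloInformed_segSpan_of_domain_eq_empty {n : ℕ} (r : IntegralRep n) (h : r.domain = ∅) :
    of r ∈ soloInformedSegSpan :=
  soloInformed_mem_segSpan_of_sub_mem (y := 0)
    (by rw [sub_zero]; exact of_mem_relations_of_volume_eq_zero r (by rw [h, measure_empty]))
    soloInformedSegSpan.zero_mem

/-- **`(A + B√(ax² + bx + c))/C` on `D ⊆ {q ≥ 0}` lies in the span of points and segments**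
(`a, b, c ∈ K`, `a ≠ 0`, `b² ≠ 4ac`, `C ≠ 0` on `D`). -/
theorem soloInformed_segSpan_of_sqrt_generalQuadratic (r : IntegralRep 1)
    (a b c : algebraicClosure ℚ ℝ) (A B C : (algebraicClosure ℚ ℝ)[X])
    (ha : algebraMap _ ℝ a ≠ 0)
    (hΔ : algebraMap _ ℝ b ^ 2 - 4 * algebraMap _ ℝ a * algebraMap _ ℝ c ≠ 0)
    (hq : ∀ x ∈ r.domain, 0 ≤ algebraMap _ ℝ a * x 0 ^ 2 + algebraMap _ ℝ b * x 0 + algebraMap _ ℝ c)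
    (hC : ∀ x ∈ r.domain, (Polynomial.aeval (x 0) C : ℝ) ≠ 0)
    (hf : EqOn r.integrand (fun x => ((Polynomial.aeval (x 0) A : ℝ) + Polynomial.aeval (x 0) B *
      Real.sqrt (algebraMap _ ℝ a * x 0 ^ 2 + algebraMap _ ℝ b * x 0 + algebraMap _ ℝ c)) /
      Polynomial.aeval (x 0) C) r.domain) :
    of r ∈ soloInformedSegSpan := by
  -- abbreviations (as equations, to keep goals syntactic)
  set a' : ℝ := algebraMap (algebraicClosure ℚ ℝ) ℝ a with ha'
  set b' : ℝ := algebraMap (algebraicClosure ℚ ℝ) ℝ b with hb'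
  set c' : ℝ := algebraMap (algebraicClosure ℚ ℝ) ℝ c with hc'
  set β : algebraicClosure ℚ ℝ := -b / (2 * a) with hβdef
  have ha0 : a ≠ 0 := fun h => ha (by rw [ha', h, map_zero])
  have hβ : algebraMap (algebraicClosure ℚ ℝ) ℝ β = -b' / (2 * a') := by
    rw [hβdef, map_div₀, map_neg, map_mul, map_ofNat]
  have hΔK : algebraMap (algebraicClosure ℚ ℝ) ℝ (b ^ 2 - 4 * a * c) = b' ^ 2 - 4 * a' * c' := by
    simp only [map_sub, map_pow, map_mul, map_ofNat]; rfl
  -- the square completed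
  have hcs : ∀ x : ℝ, a' * x ^ 2 + b' * x + c' =
      a' * (x - algebraMap (algebraicClosure ℚ ℝ) ℝ β) ^ 2 - (b' ^ 2 - 4 * a' * c') / (4 * a') :=
    fun x => by rw [hβ]; exact soloInformed_complete_square ha
  rcases lt_or_gt_of_ne ha with han | hap
  · rcases lt_or_gt_of_ne hΔ with hΔn | hΔp
    · -- `a < 0`, `Δ < 0`: `q < 0` everywhere, so the domain is empty
      refine soloInformed_segSpan_of_domain_eq_empty r (Set.eq_empty_iff_forall_notMem.2 fun x hx => ?_)
      have h := hq x hx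
      rw [hcs] at h
      have h1 : a' * (x 0 - algebraMap (algebraicClosure ℚ ℝ) ℝ β) ^ 2 ≤ 0 :=
        mul_nonpos_of_nonpos_of_nonneg han.le (sq_nonneg _)
      have h2 : 0 < (b' ^ 2 - 4 * a' * c') / (4 * a') := div_pos_of_neg_of_neg hΔn (by linarith)
      linarith
    · -- `a < 0`, `Δ > 0`: circle type `(−a)(α² − (x − β)²)`, `α = √Δ/(−2a)`
      obtain ⟨s, hs0, hss⟩ := soloInformed_exists_K_sqrt (b ^ 2 - 4 * a * c) (by rw [hΔK]; exact hΔp.le)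
      rw [hΔK] at hss
      obtain ⟨t, ht0, htt⟩ := soloInformed_exists_K_sqrt (-a) (by rw [map_neg]; linarith)
      rw [map_neg] at htt
      have hs_ne : algebraMap (algebraicClosure ℚ ℝ) ℝ s ≠ 0 := fun h => hΔ (by rw [← hss, h, mul_zero])
      have hs_pos : 0 < algebraMap (algebraicClosure ℚ ℝ) ℝ s := lt_of_le_of_ne hs0 (Ne.symm hs_ne)
      set α : algebraicClosure ℚ ℝ := s / (-2 * a) with hαdef
      have hα : algebraMap (algebraicClosure ℚ ℝ) ℝ α = algebraMap _ ℝ s / (-2 * a') := by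
        rw [hαdef, map_div₀, map_mul, map_neg, map_ofNat]
      have hαpos : 0 < algebraMap (algebraicClosure ℚ ℝ) ℝ α := by
        rw [hα]; exact div_pos hs_pos (by linarith)
      have hid : ∀ x : ℝ, a' * x ^ 2 + b' * x + c' = -a' * ((algebraMap (algebraicClosure ℚ ℝ) ℝ α) ^ 2 -
          (x - algebraMap (algebraicClosure ℚ ℝ) ℝ β) ^ 2) := fun x => by
        rw [hcs x, hα, div_pow, pow_two (algebraMap (algebraicClosure ℚ ℝ) ℝ s), hss]
        field_simp
        ring
      refine soloInformed_segSpan_of_isKSqrtQuadNaturalOne r ⟨α, β, A, B * Polynomial.C t, C, hαpos, hC,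
        Or.inr (Or.inl ⟨fun x hx => ?_, fun x hx => ?_⟩)⟩
      · have h := hq x hx
        rw [hid] at h
        have h' : (x 0 - algebraMap (algebraicClosure ℚ ℝ) ℝ β) ^ 2 ≤
            (algebraMap (algebraicClosure ℚ ℝ) ℝ α) ^ 2 := by nlinarith
        obtain ⟨h1, h2⟩ := abs_le_of_sq_le_sq' h' hαpos.le
        constructor <;> linarith
      · rw [hf hx]
        show ((Polynomial.aeval (x 0) A : ℝ) + Polynomial.aeval (x 0) B *
            Real.sqrt (a' * x 0 ^ 2 + b' * x 0 + c')) / Polynomial.aeval (x 0) C = _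
        rw [hid, soloInformed_sqrt_mul_of_sq ht0 htt]
        simp only [map_mul, Polynomial.aeval_C]
        ring
  · rcases lt_or_gt_of_ne hΔ with hΔn | hΔp
    · -- `a > 0`, `Δ < 0`: `a((x − β)² + α²)`, `α = √(−Δ)/(2a)`, any domain
      obtain ⟨s, hs0, hss⟩ := soloInformed_exists_K_sqrt (-(b ^ 2 - 4 * a * c))
        (by rw [map_neg, hΔK]; linarith)
      rw [map_neg, hΔK] at hss
      obtain ⟨t, ht0, htt⟩ := soloInformed_exists_K_sqrt a hap.le
      set α : algebraicClosure ℚ ℝ := s / (2 * a) with hαdef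
      have hs_ne : algebraMap (algebraicClosure ℚ ℝ) ℝ s ≠ 0 := fun h => hΔ (by
        have := hss; rw [h, mul_zero] at this; linarith)
      have hs_pos : 0 < algebraMap (algebraicClosure ℚ ℝ) ℝ s := lt_of_le_of_ne hs0 (Ne.symm hs_ne)
      have hα : algebraMap (algebraicClosure ℚ ℝ) ℝ α = algebraMap _ ℝ s / (2 * a') := by
        rw [hαdef, map_div₀, map_mul, map_ofNat]
      have hαpos : 0 < algebraMap (algebraicClosure ℚ ℝ) ℝ α := by
        rw [hα]; exact div_pos hs_pos (by linarith)
      have hid : ∀ x : ℝ, a' * x ^ 2 + b' * x + c' = a' * ((x - algebraMap (algebraicClosure ℚ ℝ) ℝ β) ^ 2 +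
          (algebraMap (algebraicClosure ℚ ℝ) ℝ α) ^ 2) := fun x => by
        rw [hcs x, hα, div_pow, pow_two (algebraMap (algebraicClosure ℚ ℝ) ℝ s), hss]
        field_simp
        ring
      refine soloInformed_segSpan_of_isKSqrtQuadNaturalOne r ⟨α, β, A, B * Polynomial.C t, C, hαpos, hC,
        Or.inl fun x hx => ?_⟩
      rw [hf hx]
      show ((Polynomial.aeval (x 0) A : ℝ) + Polynomial.aeval (x 0) B *
          Real.sqrt (a' * x 0 ^ 2 + b' * x 0 + c')) / Polynomial.aeval (x 0) C = _
      rw [hid, soloInformed_sqrt_mul_of_sq ht0 htt]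
      simp only [map_mul, Polynomial.aeval_C]
      ring
    · -- `a > 0`, `Δ > 0`: `a((x − β)² − α²)`, `α = √Δ/(2a)`, domain `|x − β| ≥ α`
      obtain ⟨s, hs0, hss⟩ := soloInformed_exists_K_sqrt (b ^ 2 - 4 * a * c) (by rw [hΔK]; exact hΔp.le)
      rw [hΔK] at hss
      obtain ⟨t, ht0, htt⟩ := soloInformed_exists_K_sqrt a hap.le
      set α : algebraicClosure ℚ ℝ := s / (2 * a) with hαdef
      have hs_ne : algebraMap (algebraicClosure ℚ ℝ) ℝ s ≠ 0 := fun h => hΔ (by rw [← hss, h, mul_zero])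
      have hs_pos : 0 < algebraMap (algebraicClosure ℚ ℝ) ℝ s := lt_of_le_of_ne hs0 (Ne.symm hs_ne)
      have hα : algebraMap (algebraicClosure ℚ ℝ) ℝ α = algebraMap _ ℝ s / (2 * a') := by
        rw [hαdef, map_div₀, map_mul, map_ofNat]
      have hαpos : 0 < algebraMap (algebraicClosure ℚ ℝ) ℝ α := by
        rw [hα]; exact div_pos hs_pos (by linarith)
      have hid : ∀ x : ℝ, a' * x ^ 2 + b' * x + c' = a' * ((x - algebraMap (algebraicClosure ℚ ℝ) ℝ β) ^ 2 -
          (algebraMap (algebraicClosure ℚ ℝ) ℝ α) ^ 2) := fun x => by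
        rw [hcs x, hα, div_pow, pow_two (algebraMap (algebraicClosure ℚ ℝ) ℝ s), hss]
        field_simp
        ring
      refine soloInformed_segSpan_of_isKSqrtQuadNaturalOne r ⟨α, β, A, B * Polynomial.C t, C, hαpos, hC,
        Or.inr (Or.inr ⟨fun x hx => ?_, fun x hx => ?_⟩)⟩
      · have h := hq x hx
        rw [hid] at h
        have h' : (algebraMap (algebraicClosure ℚ ℝ) ℝ α) ^ 2 ≤
            (x 0 - algebraMap (algebraicClosure ℚ ℝ) ℝ β) ^ 2 := by nlinarith
        have habs : algebraMap (algebraicClosure ℚ ℝ) ℝ α ≤ |x 0 - algebraMap (algebraicClosure ℚ ℝ) ℝ β| := by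
          have := Real.sqrt_le_sqrt h'
          rwa [Real.sqrt_sq hαpos.le, Real.sqrt_sq_eq_abs] at this
        rcases le_abs'.1 habs with h1 | h1
        · left; linarith
        · right; linarith
      · rw [hf hx]
        show ((Polynomial.aeval (x 0) A : ℝ) + Polynomial.aeval (x 0) B *
            Real.sqrt (a' * x 0 ^ 2 + b' * x 0 + c')) / Polynomial.aeval (x 0) C = _
        rw [hid, soloInformed_sqrt_mul_of_sq ht0 htt]
        simp only [map_mul, Polynomial.aeval_C]
        ring

/-- **The period conjecture for `∫_D (A + B√(ax² + bx + c))/C dx`, arbitrary non-degenerate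
quadratic over `K`, `D ⊆ {q ≥ 0}`:** KZ-equivalent to every elementary one-variable integral, every
rational representation of dimension `≤ 1`, and every member of the span of points and segments
with the same value.  Unconditional. [Kontsevich–Zagier 2001, §1.2 Question 1; this work] -/
theorem soloInformed_kzp_sqrt_generalQuadratic (r : IntegralRep 1)
    (a b c : algebraicClosure ℚ ℝ) (A B C : (algebraicClosure ℚ ℝ)[X])
    (ha : algebraMap _ ℝ a ≠ 0)
    (hΔ : algebraMap _ ℝ b ^ 2 - 4 * algebraMap _ ℝ a * algebraMap _ ℝ c ≠ 0)
    (hq : ∀ x ∈ r.domain, 0 ≤ algebraMap _ ℝ a * x 0 ^ 2 + algebraMap _ ℝ b * x 0 + algebraMap _ ℝ c)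
    (hC : ∀ x ∈ r.domain, (Polynomial.aeval (x 0) C : ℝ) ≠ 0)
    (hf : EqOn r.integrand (fun x => ((Polynomial.aeval (x 0) A : ℝ) + Polynomial.aeval (x 0) B *
      Real.sqrt (algebraMap _ ℝ a * x 0 ^ 2 + algebraMap _ ℝ b * x 0 + algebraMap _ ℝ c)) /
      Polynomial.aeval (x 0) C) r.domain) :
    (∀ r₁ : IntegralRep 1, SoloInformedIsKElementaryOne r₁ → r.value = r₁.value → Equivalent r r₁) ∧
    (∀ {n : ℕ} (hn : n ≤ 1) (r₀ : IntegralRep n), r₀.IsRational → r.value = r₀.value →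
      Equivalent r r₀) ∧
    (∀ {m : ℕ} (r₂ : IntegralRep m), of r₂ ∈ soloInformedSegSpan → r.value = r₂.value →
      Equivalent r r₂) := by
  have h := soloInformed_segSpan_of_sqrt_generalQuadratic r a b c A B C ha hΔ hq hC hf
  exact ⟨fun r₁ hr₁ hv => soloInformed_equivalent_of_mem_segSpan h
      (soloInformed_segSpan_of_isKElementaryOne r₁ hr₁) hv,
    fun hn r₀ hr₀ hv => soloInformed_equivalent_of_mem_segSpan h
      (soloInformed_of_mem_segSpan_of_isRational hn r₀ hr₀) hv,
    fun r₂ hr₂ hv => soloInformed_equivalent_of_mem_segSpan h hr₂ hv⟩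

/-- In particular two such integrals (possibly with different quadratics) with equal values are
equivalent. -/
theorem soloInformed_kzp_sqrt_generalQuadratic_pair (r r' : IntegralRep 1)
    (a b c : algebraicClosure ℚ ℝ) (A B C : (algebraicClosure ℚ ℝ)[X])
    (a₁ b₁ c₁ : algebraicClosure ℚ ℝ) (A₁ B₁ C₁ : (algebraicClosure ℚ ℝ)[X])
    (ha : algebraMap _ ℝ a ≠ 0)
    (hΔ : algebraMap _ ℝ b ^ 2 - 4 * algebraMap _ ℝ a * algebraMap _ ℝ c ≠ 0)
    (hq : ∀ x ∈ r.domain, 0 ≤ algebraMap _ ℝ a * x 0 ^ 2 + algebraMap _ ℝ b * x 0 + algebraMap _ ℝ c)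
    (hC : ∀ x ∈ r.domain, (Polynomial.aeval (x 0) C : ℝ) ≠ 0)
    (hf : EqOn r.integrand (fun x => ((Polynomial.aeval (x 0) A : ℝ) + Polynomial.aeval (x 0) B *
      Real.sqrt (algebraMap _ ℝ a * x 0 ^ 2 + algebraMap _ ℝ b * x 0 + algebraMap _ ℝ c)) /
      Polynomial.aeval (x 0) C) r.domain)
    (ha₁ : algebraMap _ ℝ a₁ ≠ 0)
    (hΔ₁ : algebraMap _ ℝ b₁ ^ 2 - 4 * algebraMap _ ℝ a₁ * algebraMap _ ℝ c₁ ≠ 0)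
    (hq₁ : ∀ x ∈ r'.domain, 0 ≤ algebraMap _ ℝ a₁ * x 0 ^ 2 + algebraMap _ ℝ b₁ * x 0 + algebraMap _ ℝ c₁)
    (hC₁ : ∀ x ∈ r'.domain, (Polynomial.aeval (x 0) C₁ : ℝ) ≠ 0)
    (hf₁ : EqOn r'.integrand (fun x => ((Polynomial.aeval (x 0) A₁ : ℝ) + Polynomial.aeval (x 0) B₁ *
      Real.sqrt (algebraMap _ ℝ a₁ * x 0 ^ 2 + algebraMap _ ℝ b₁ * x 0 + algebraMap _ ℝ c₁)) /
      Polynomial.aeval (x 0) C₁) r'.domain)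
    (hv : r.value = r'.value) : Equivalent r r' :=
  soloInformed_equivalent_of_mem_segSpan
    (soloInformed_segSpan_of_sqrt_generalQuadratic r a b c A B C ha hΔ hq hC hf)
    (soloInformed_segSpan_of_sqrt_generalQuadratic r' a₁ b₁ c₁ A₁ B₁ C₁ ha₁ hΔ₁ hq₁ hC₁ hf₁) hv

end Summit.KontsevichZagierPeriods.KontsevichZagierPeriods.Theorems
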